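import Summits.ABC.IUTFork.LanaKummerTempered
import Summits.ABC.IUTFork.LanaKummerAmbientTower
import Summits.ABC.IUTFork.LanaPadicGalois
import HarnessLib

/-!
# L-LANA objects XII septies: the Kummer towers `κ : ℚ̄_p^× → ∞H¹(Π^temp_{X_K}, Λ)` and `κ_x : ℚ̄_p^× → ∞H¹(D_x, Λ)` over the tree's tempered curves — INJECTIVE, no hypothesis

Record-only file (D-0012) of the abc-iut cell (seat abc-iut-c312-4, L-LANA level, plan/LLANA-SPEC N13/N14 Step 6;
CONSUMES L3's `TemperedCurve` and L4's `divisibleElementsTrivial_units_of_finite_padic`); TAKES NO SIDE on [IUTchIII]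
Cor. 3.12. LANA §6.2 (g) p. 35: "For each `t`, set `C_v := (l·Δ_Θ)(Π_v)`, which we regard as a `D_t`-module. We also
have a cyclotome `Λ_{v,t} := Λ(K̄_{v,t}) = lim_n μ_n(K̄_{v,t})`, which is naturally a `D_t`-module. … Then we have a
map `φ_{v,t} = (ι_t)_*⁻¹ ∘ κ_t : O^▷_{v,t} → ∞H¹(D_t, C_v)`, where `κ_t : O^▷_{v,t} → ∞H¹(D_t, Λ_{v,t})` is the local
Kummer map"; §6.1 p. 32: "`∞H^i(G, A) := lim_J H^i(G|_J, A)`". Over `LanaKummerAmbientTower.lean` (`Ω := ℚ̄_p`,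
`k := ℚ_p`) and the tempered-curve plug `LanaKummerTempered.lean`:

* `TemperedCurveRef.kummerTowerPi X : ℚ̄_p^× → ∞H¹(Π^temp_{X_K}, Λ(ℚ̄_p^×))` (levels `aug⁻¹(U)`, `U ⊴ G_{ℚ_p}` open)
  and **`kummerTowerPi_injective`** — injective on ALL of `ℚ̄_p^×`, NO hypothesis (`G_K` is open since `K/ℚ_p` is
  finite; every finite subextension of `ℚ̄_p/ℚ_p` has `⋂_n (E^×)^n = 1`, L4);
* for EVERY closed point `x` (cusp or not): `kummerTowerDecomp X x : ℚ̄_p^× → ∞H¹(D_x, Λ(ℚ̄_p^×))`, `D_x` acting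
  through the augmentation, **`kummerTowerDecomp_injective`** — NO hypothesis (`aug(D_x)` is open, L3
  `isOpen_aug_decomp`); and its restriction to the integral monoid, **`kummerTowerIntDecomp X x : O^▷_{ℚ̄_p} →
  ∞H¹(D_x, Λ(ℚ̄_p^×))` = LANA's `κ_t`** (with `O^▷_{v,t}` read as the integral monoid of `K̄_{v,t} = ℚ̄_p`, as in
  gen-2's `LanaKummerTower.kummerTowerInt`), injective (`kummerTowerIntDecomp_injective`) — the hypothesis `hκ` of
  `LanaEtaAlgorithm.phiProd_injective` DISCHARGED over REAL decomposition groups (sibling `LanaEtaTemperedKappa.lean`).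

Modelling notes: as in `LanaKummerAmbientTower.lean` (index system `ρ⁻¹(U)`; for `D_x` at a non-cusp `ρ` is injective,
`LanaKummerTempered.aug_injective_decomp`, so these ARE the open subgroups of `D_x ≅ G_{K_x}` pulled back from
`G_{ℚ_p}`); discrete Mathlib `H¹`. [cite: LANA2026Report, §6.2 (g) p. 35, §6.1 pp. 31–32, §4.2 (b) p. 26]
NOT here: the interior coefficients `C_v` / cyclotomic synchronization `ι_t` (theta side); any judgement.
-/

noncomputable section

namespace Summit.ABC
namespace IUTFork
namespace TemperedCurveRef

open Literature.AnabelianGeometry.SemiGraphs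
open Literature.AnabelianGeometry.EtaleTheta
open Literature.AnabelianGeometry.AbsoluteAnabelian.AbsTopIII (DivisibleElementsTrivial)
open scoped NNReal

variable {p : ℕ} [Fact p.Prime] (X : TemperedCurve p)

/-! ## 0. The two hypotheses of `Ambient.kummerTower_injective_of`, discharged over `ℚ̄_p/ℚ_p` -/

omit X in
/-- **Every finite subextension `E` of `ℚ̄_p/ℚ_p` has `⋂_n (E^×)^n = 1`** (L4, [AbsTopIII] Rmk. 1.5.4 (i)).
[cite: MochizukiAbsTopIII2015, Rmk 1.5.4 (i) p.33] -/
theorem divisibleElementsTrivial_of_finite (E : IntermediateField ℚ_[p] (AlgebraicClosure ℚ_[p]))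
    (hE : FiniteDimensional ℚ_[p] ↥E) : DivisibleElementsTrivial (↥E)ˣ := by
  haveI := hE
  exact Literature.AnabelianGeometry.AbsoluteAnabelian.AbsTopIII.divisibleElementsTrivial_units_of_finite_padic p ↥E

/-- **`G_K = aug(Π^temp_{X_K})` is OPEN in `G_{ℚ_p}`** (`K/ℚ_p` finite). [cite: MochizukiSemiAnbd2006, §6 p.69] -/
theorem isOpen_rho_range : IsOpen (((rho X).range : Subgroup (GQp p)) : Set (GQp p)) := by
  haveI : FiniteDimensional ℚ_[p] ↥X.K := X.finiteDimensional_K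
  rw [rho_range]
  exact X.K.fixingSubgroup_isOpen

/-! ## 1. The tower over `Π^temp_{X_K}` -/

/-- **`κ : ℚ̄_p^× → ∞H¹(Π^temp_{X_K}, Λ(ℚ̄_p^×)) := lim_{→ U} H¹(aug⁻¹U, Λ(ℚ̄_p^×))`**, `Π^temp` acting through the
augmentation. [cite: LANA2026Report, §6.1 p. 31, §4.2 (b) p. 26] -/
def kummerTowerPi : Additive (Ambient.ViaUnits (rho X)) →+ Ambient.H1Tower (rho X) :=
  Ambient.kummerTower (rho X)

/-- **`κ` over `Π^temp_{X_K}` is INJECTIVE on all of `ℚ̄_p^×` — no hypothesis.** [cite: LANA2026Report, §6.1 p. 31] -/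
theorem kummerTowerPi_injective : Function.Injective (kummerTowerPi X) :=
  Ambient.kummerTower_injective_of (rho X) (isOpen_rho_range X) divisibleElementsTrivial_of_finite

/-- `κ(a) = 0 ⟺ a = 1` on `ℚ̄_p^×`. [cite: LANA2026Report, §6.1 p. 31] -/
theorem kummerTowerPi_eq_zero_iff (a : Ambient.ViaUnits (rho X)) :
    kummerTowerPi X (Additive.ofMul a) = 0 ↔ a = 1 :=
  Ambient.kummerTower_eq_zero_iff_of (rho X) (isOpen_rho_range X) divisibleElementsTrivial_of_finite a

/-! ## 2. The tower over a decomposition group `D_x` ("`∞H¹(D_t, Λ_{v,t})`") -/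

variable (x : X.Pt)

/-- `aug(D_x)` is open (L3 `isOpen_aug_decomp`; for every closed point, cusp or not).
[cite: MochizukiSemiAnbd2006, §6 p.71] -/
theorem isOpen_rhoDecomp_range : IsOpen (((rhoDecomp X x).range : Subgroup (GQp p)) : Set (GQp p)) := by
  rw [rhoDecomp_range]
  exact isOpen_map_decomp X x

/-- **`κ_x : ℚ̄_p^× → ∞H¹(D_x, Λ(ℚ̄_p^×)) := lim_{→ U} H¹(D_x ∩ aug⁻¹U, Λ(ℚ̄_p^×))`**, `D_x` acting through the
augmentation — LANA §6.2 (g)'s "`∞H¹(D_t, Λ_{v,t})`, … naturally a `D_t`-module" with its Kummer map.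
[cite: LANA2026Report, §6.2 (g) p. 35] -/
def kummerTowerDecomp : Additive (Ambient.ViaUnits (rhoDecomp X x)) →+ Ambient.H1Tower (rhoDecomp X x) :=
  Ambient.kummerTower (rhoDecomp X x)

/-- **`κ_x` is INJECTIVE on all of `ℚ̄_p^×` — no hypothesis.** [cite: LANA2026Report, §6.2 (g) p. 36] -/
theorem kummerTowerDecomp_injective : Function.Injective (kummerTowerDecomp X x) :=
  Ambient.kummerTower_injective_of (rhoDecomp X x) (isOpen_rhoDecomp_range X x) divisibleElementsTrivial_of_finite

/-- `κ_x(a) = 0 ⟺ a = 1`. [cite: LANA2026Report, §6.2 (g) p. 36] -/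
theorem kummerTowerDecomp_eq_zero_iff (a : Ambient.ViaUnits (rhoDecomp X x)) :
    kummerTowerDecomp X x (Additive.ofMul a) = 0 ↔ a = 1 :=
  Ambient.kummerTower_eq_zero_iff_of (rhoDecomp X x) (isOpen_rhoDecomp_range X x) divisibleElementsTrivial_of_finite a

/-! ## 3. `κ_t` on the integral monoid `O^▷_{ℚ̄_p}` -/

section IntMonoid

variable {P : Type} [Group P] (ρ : P →* GQp p)

omit X x in
/-- `O^▷_{ℚ̄_p} → ℚ̄_p^×` (an integral element of positive absolute value is a unit of the field), into the
`P`-through-`ρ` copy of `ℚ̄_p^×`. [cite: LANA2026Report, §0.4 (b) p. 8] -/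
def intMonoidToViaUnits : intMonoid (padicVal p) →* Ambient.ViaUnits ρ where
  toFun a := Ambient.ViaUnits.of ρ (Units.mk0 (a : PadicAlgCl p) ((Valuation.pos_iff (padicVal p)).mp a.2.1))
  map_one' := (Ambient.ViaUnits.of ρ).symm.injective (Units.ext (by simp [Ambient.ViaUnits.of]))
  map_mul' a b := (Ambient.ViaUnits.of ρ).symm.injective (Units.ext (by simp [Ambient.ViaUnits.of]))

omit X x in
/-- Underlying element. [cite: LANA2026Report, §0.4 (b) p. 8] -/
@[simp] theorem coe_intMonoidToViaUnits (a : intMonoid (padicVal p)) :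
    (((Ambient.ViaUnits.of ρ).symm (intMonoidToViaUnits ρ a) : (PadicAlgCl p)ˣ) : PadicAlgCl p) = a := rfl

omit X x in
/-- `O^▷ → ℚ̄_p^×` is injective. [folklore] -/
theorem intMonoidToViaUnits_injective : Function.Injective (intMonoidToViaUnits ρ) := fun a b h => by
  have h' := congrArg (fun u : Ambient.ViaUnits ρ => (((Ambient.ViaUnits.of ρ).symm u : (PadicAlgCl p)ˣ) : PadicAlgCl p)) h
  simp only [coe_intMonoidToViaUnits] at h'
  exact Subtype.ext h'

end IntMonoid

/-- **`κ_t : O^▷ → ∞H¹(D_t, Λ)` REALISED at the decomposition group `D_x`**: the tower Kummer map restricted to the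
integral monoid `O^▷_{ℚ̄_p}` (multiplicatively written target) — the object the slot `EtaSteps.kappa` of
`LanaEtaAlgorithm.lean` stands for, over a REAL tempered curve. [cite: LANA2026Report, §6.2 (g) p. 35] -/
def kummerTowerIntDecomp : intMonoid (padicVal p) →* Multiplicative (Ambient.H1Tower (rhoDecomp X x)) :=
  (AddMonoidHom.toMultiplicativeRight (kummerTowerDecomp X x)).comp (intMonoidToViaUnits (rhoDecomp X x))

/-- `κ_t` on `O^▷` is `κ_x` restricted. [cite: LANA2026Report, §6.2 (g) p. 35] -/
theorem toAdd_kummerTowerIntDecomp (a : intMonoid (padicVal p)) :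
    (kummerTowerIntDecomp X x a).toAdd =
      kummerTowerDecomp X x (Additive.ofMul (intMonoidToViaUnits (rhoDecomp X x) a)) := rfl

/-- **`κ_t : O^▷ → ∞H¹(D_x, Λ)` is INJECTIVE — no hypothesis** (the `hκ` of `LanaEtaAlgorithm.phiProd_injective`,
DISCHARGED over the decomposition groups of the tree's tempered curves). [cite: LANA2026Report, §6.2 (g) p. 36] -/
theorem kummerTowerIntDecomp_injective : Function.Injective (kummerTowerIntDecomp X x) := fun a b h => by
  apply intMonoidToViaUnits_injective (rhoDecomp X x)
  have h' := congrArg Multiplicative.toAdd h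
  rw [toAdd_kummerTowerIntDecomp, toAdd_kummerTowerIntDecomp] at h'
  exact Additive.ofMul.injective (kummerTowerDecomp_injective X x h')

/-- The same over `Π^temp_{X_K}` itself: `κ : O^▷ → ∞H¹(Π^temp, Λ)`. [cite: LANA2026Report, §6.1 p. 31] -/
def kummerTowerIntPi : intMonoid (padicVal p) →* Multiplicative (Ambient.H1Tower (rho X)) :=
  (AddMonoidHom.toMultiplicativeRight (kummerTowerPi X)).comp (intMonoidToViaUnits (rho X))

/-- … injective, no hypothesis. [cite: LANA2026Report, §6.1 p. 31] -/
theorem kummerTowerIntPi_injective : Function.Injective (kummerTowerIntPi X) := fun a b h => by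
  apply intMonoidToViaUnits_injective (rho X)
  have h' := congrArg Multiplicative.toAdd h
  exact Additive.ofMul.injective (kummerTowerPi_injective X h')

end TemperedCurveRef

end IUTFork

end Summit.ABC

end
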